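import Summits.ResolutionOfSingularities.ResolutionOfSingularities.Theorems.PurelyInseparableDim4AtlasLinearEscapingPackage
import HarnessLib

/-!
# Purely inseparable four-folds: the MODEL CHARTS of an atlas child — re-centrings, readings, order bounds and cover for the main chart
# and the extra charts (brick S3 (c) v4, tranche 1, brick A1-model; cell `res-dim4-pi`)

[OURS · counted 0] (D-0157 DOOR 2; host item stmt-ResolutionOfSingularities-16155, helper). Nothing here proves resolution of
singularities in dimension ≥ 4 / characteristic `p`. Model side of the child package A1 (`res-dim4-typ-3/S3c-V4-ATLAS-MEMBERS-DESIGN.md` §10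
step (1)), uniform in the two cases of an entry `(j, b, S″)` (`j ∈ S ∩ S″`, `b_j = 0`) at a member with centre `V(z, x_S)`: NON-ESCAPING
(`S ⊆ S″`; typ-2's `globalCentre_atlas_package_boundary_nearFar` with empty boundary lists on the main chart) or LINEAR ESCAPING (`S ⊄ S″`,
`b|_S = 0`; A1b `globalCentre_atlas_package_linearEscaping` adds the translation re-centrings of the extra charts `l ∈ S ∖ S″` with the
explicit states `escState`). OUTPUT, indexed by the charts `m ∈ S` with `m = j ∨ m ∉ S″`: re-centrings `Θ_m` (translation by `b`, a cleaning
in `z`), the model centre `Zm = 𝓘(closure of (Spec Θ_j ≫ chartImm_j)(V(z, x_{S″})))` reading `𝓘Λ(T_m)` on chart `m` (`T_j = S″`,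
`T_l = insert l (S″ ∖ {j})`), the model transform reading `(z^p + F_m)·𝒪` (`F_j` = v3's step state, `F_l = escState`), `p ≤ ord` along `T_m`,
and the cover of `V(Zm)` by these charts.

* **`atlas_child_model`**. AI-produced formalisation, weaker than expert review.
bears_on: LADDER-RESOLUTION:D157-DOOR2 (res-dim4-pi · S3 (c) v4 A1-model).
-/

set_option linter.dupNamespace false -- D-0017: single-problem summit path `Summit.<S>.<S>.…` by design

noncomputable section

open MvPolynomial Finset CategoryTheory AlgebraicGeometry Opposite TopologicalSpace
open AlgebraicGeometry.Scheme.IdealSheafData (ofIdealTop vanishingIdeal)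

namespace Summit.ResolutionOfSingularities.ResolutionOfSingularities.Theorems.PIDim4

open Literature.AlgebraicGeometry.Resolution
open Literature.AlgebraicGeometry.Resolution.Hauser2010
open Literature.AlgebraicGeometry.Resolution.AffinePointBlowup (P A γ coord Wtop ξ)

namespace Equimultiple

section ChildModel

variable {K : Type} [Field K] {p : ℕ} [hp : Fact p.Prime] [CharP K p] [DecidableEq K]
variable {Bl : Scheme.{0}} {B : Bl ⟶ P 4 K} {S : Finset (Fin 4)}

/-- **THE MODEL CHARTS OF AN ATLAS CHILD.** See the module docstring. [cite: BierstoneGrigorievMilmanWlodarczyk2011, §4 Step 2b]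
[cite: HauserPerlega2019PRIMS, §2] [cite: Hauser2010, §G] -/
theorem atlas_child_model [IsAlgClosed K]
    (hB : IsBlowup B (AffineCoordBlowup.𝓘Λ 4 K (insert 0 (Fin.succ '' (S : Set (Fin 4))))))
    (s : State K) (hF : s.F ≠ 0) (hclean : Literature.Barriers.ResolutionOfSingularities.HauserPerlega.IsClean p s.F)
    (hperm : (p : ℕ∞) ≤ CentreBlowup.ordAlong S s.F)
    {j : Fin 4} (hj : j ∈ S) {b : Fin 4 → K} (hbj : b j = 0) {S'' : Finset (Fin 4)} (hjS'' : j ∈ S'')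
    (hbE : ¬ S ⊆ S'' → ∀ i ∈ S, b i = 0)
    (hperm' : (p : ℕ∞) ≤ CentreBlowup.ordAlong S'' (CentreBlowup.step p S j b s).F) :
    ∃ Θ : Fin 4 → (A 4 K ≃ₐ[K] A 4 K),
      (∀ (m : Fin 4), m ∈ S → (m = j ∨ m ∉ S'') → ∀ i : Fin 4, Θ m (X i.succ) = X i.succ + C (b i)) ∧
      (∀ (m : Fin 4), m ∈ S → (m = j ∨ m ∉ S'') → ∃ h : MvPolynomial (Fin 4) K, Θ m (X 0) = X 0 + rename Fin.succ h) ∧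
      (∀ (m : Fin 4) (hmS : m ∈ S), (m = j ∨ m ∉ S'') →
        (vanishingIdeal (closureImage
            (Spec.map (CommRingCat.ofHom (Θ j : A 4 K →+* A 4 K)) ≫ AffineCoordBlowup.chartImm hB (ChartDictionary.succ_mem_centreVars hj))
            ((AffineCoordBlowup.𝓘Λ 4 K (insert 0 (Fin.succ '' (S'' : Set (Fin 4))))).support : Set (P 4 K)))).comap
          (Spec.map (CommRingCat.ofHom (Θ m : A 4 K →+* A 4 K)) ≫ AffineCoordBlowup.chartImm hB (ChartDictionary.succ_mem_centreVars hmS)) =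
          AffineCoordBlowup.𝓘Λ 4 K (insert 0 (Fin.succ ''
            ((if m = j then S'' else insert m (S''.erase j) : Finset (Fin 4)) : Set (Fin 4)))) ∧
        (controlledTransform B (AffineCoordBlowup.𝓘Λ 4 K (insert 0 (Fin.succ '' (S : Set (Fin 4))))) (hypSheaf p s.F) p).comap
            (Spec.map (CommRingCat.ofHom (Θ m : A 4 K →+* A 4 K)) ≫ AffineCoordBlowup.chartImm hB (ChartDictionary.succ_mem_centreVars hmS)) =
          hypSheaf p (if m = j then (CentreBlowup.step p S j b s).F else (escState p S m b s).F) ∧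
        (p : ℕ∞) ≤ CentreBlowup.ordAlong (if m = j then S'' else insert m (S''.erase j))
          (if m = j then (CentreBlowup.step p S j b s).F else (escState p S m b s).F)) ∧
      (((vanishingIdeal (closureImage
          (Spec.map (CommRingCat.ofHom (Θ j : A 4 K →+* A 4 K)) ≫ AffineCoordBlowup.chartImm hB (ChartDictionary.succ_mem_centreVars hj))
          ((AffineCoordBlowup.𝓘Λ 4 K (insert 0 (Fin.succ '' (S'' : Set (Fin 4))))).support : Set (P 4 K)))).support : Set Bl) ⊆
        ⋃ (m : Fin 4) (hmS : m ∈ S) (_ : m = j ∨ m ∉ S''),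
          Set.range (Spec.map (CommRingCat.ofHom (Θ m : A 4 K →+* A 4 K)) ≫
            AffineCoordBlowup.chartImm hB (ChartDictionary.succ_mem_centreVars hmS))) := by
  classical
  obtain ⟨Θⱼ, hh, hΘ0, hΘs, hMj, hZj, hcov, hrest⟩ : ∃ (Θⱼ : A 4 K ≃ₐ[K] A 4 K) (hh : MvPolynomial (Fin 4) K),
      Θⱼ (X 0) = X 0 + rename Fin.succ hh ∧ (∀ i : Fin 4, Θⱼ (X i.succ) = X i.succ + C (b i)) ∧
      ((⟨hypSheaf p s.F, [], p⟩ : MarkedIdeal (P 4 K)).transform B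
          (AffineCoordBlowup.𝓘Λ 4 K (insert 0 (Fin.succ '' (S : Set (Fin 4)))))).ideal.comap
        (Spec.map (CommRingCat.ofHom (Θⱼ : A 4 K →+* A 4 K)) ≫ AffineCoordBlowup.chartImm hB (ChartDictionary.succ_mem_centreVars hj)) =
        hypSheaf p (CentreBlowup.step p S j b s).F ∧
      (vanishingIdeal (closureImage
          (Spec.map (CommRingCat.ofHom (Θⱼ : A 4 K →+* A 4 K)) ≫ AffineCoordBlowup.chartImm hB (ChartDictionary.succ_mem_centreVars hj))
          ((AffineCoordBlowup.𝓘Λ 4 K (insert 0 (Fin.succ '' (S'' : Set (Fin 4))))).support : Set (P 4 K)))).comap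
        (Spec.map (CommRingCat.ofHom (Θⱼ : A 4 K →+* A 4 K)) ≫ AffineCoordBlowup.chartImm hB (ChartDictionary.succ_mem_centreVars hj)) =
        AffineCoordBlowup.𝓘Λ 4 K (insert 0 (Fin.succ '' (S'' : Set (Fin 4)))) ∧
      (((vanishingIdeal (closureImage
          (Spec.map (CommRingCat.ofHom (Θⱼ : A 4 K →+* A 4 K)) ≫ AffineCoordBlowup.chartImm hB (ChartDictionary.succ_mem_centreVars hj))
          ((AffineCoordBlowup.𝓘Λ 4 K (insert 0 (Fin.succ '' (S'' : Set (Fin 4))))).support : Set (P 4 K)))).support : Set Bl) ⊆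
        ⋃ (l : Fin 4) (hl : l ∈ S \ S''.erase j),
          ((AffineCoordBlowup.chartImm hB (ChartDictionary.succ_mem_centreVars (Finset.mem_sdiff.mp hl).1)).opensRange : Set Bl)) ∧
      ∀ (l : Fin 4) (hl : l ∈ S), l ∉ S'' → ∃ (Θ : A 4 K ≃ₐ[K] A 4 K) (g : MvPolynomial (Fin 4) K),
        Θ (X 0) = X 0 + rename Fin.succ g ∧ (∀ i : Fin 4, Θ (X i.succ) = X i.succ + C (b i)) ∧
        ((⟨hypSheaf p s.F, [], p⟩ : MarkedIdeal (P 4 K)).transform B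
            (AffineCoordBlowup.𝓘Λ 4 K (insert 0 (Fin.succ '' (S : Set (Fin 4)))))).ideal.comap
          (Spec.map (CommRingCat.ofHom (Θ : A 4 K →+* A 4 K)) ≫ AffineCoordBlowup.chartImm hB (ChartDictionary.succ_mem_centreVars hl)) =
          hypSheaf p (escState p S l b s).F ∧
        (vanishingIdeal (closureImage
            (Spec.map (CommRingCat.ofHom (Θⱼ : A 4 K →+* A 4 K)) ≫ AffineCoordBlowup.chartImm hB (ChartDictionary.succ_mem_centreVars hj))
            ((AffineCoordBlowup.𝓘Λ 4 K (insert 0 (Fin.succ '' (S'' : Set (Fin 4))))).support : Set (P 4 K)))).comap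
          (Spec.map (CommRingCat.ofHom (Θ : A 4 K →+* A 4 K)) ≫ AffineCoordBlowup.chartImm hB (ChartDictionary.succ_mem_centreVars hl)) =
          AffineCoordBlowup.𝓘Λ 4 K (insert 0 (Fin.succ '' ((insert l (S''.erase j) : Finset (Fin 4)) : Set (Fin 4)))) ∧
        (p : ℕ∞) ≤ CentreBlowup.ordAlong (insert l (S''.erase j)) (escState p S l b s).F := by
    by_cases hesc : S ⊆ S''
    · obtain ⟨Θⱼ, hh, -, hΘ0, hΘs, ⟨hMj, hZj, -, -, -⟩, hcov, -⟩ :=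
        ChartDictionary.globalCentre_atlas_package_boundary_nearFar (π := B) hj hbj s hF hclean hperm hB hperm' [] [] 0 0
          (fun _ _ => rfl) (fun i hi => absurd hi (List.not_mem_nil)) (fun i hi => absurd hi (List.not_mem_nil))
          (fun h => absurd h (List.not_mem_nil)) (fun m hm => absurd hm (List.not_mem_nil))
          (fun _ i hi => absurd hi (List.not_mem_nil)) (fun _ i hi => absurd hi (List.not_mem_nil))
      exact ⟨Θⱼ, hh, hΘ0, hΘs, hMj, hZj, hcov, fun l hl hlS'' => absurd (hesc hl) hlS''⟩
    · obtain ⟨Θⱼ, hh, -, hΘ0, hΘs, ⟨hMj, hZj, -, -, -⟩, hcov, hrest⟩ :=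
        globalCentre_atlas_package_linearEscaping (π := B) hj hjS'' (hbE hesc) s hF hclean hperm hB hperm' [] [] 0 0
          (fun _ _ => rfl) (fun i hi => absurd hi (List.not_mem_nil)) (fun i hi => absurd hi (List.not_mem_nil))
      refine ⟨Θⱼ, hh, hΘ0, hΘs, hMj, hZj, hcov, fun l hl hlS'' => ?_⟩
      obtain ⟨Θ, g, -, h0, hs', hM, hZ, -, -, hord, -⟩ := hrest l hl hlS''
      exact ⟨Θ, g, h0, hs', hM, hZ, hord⟩
  choose Θl gl hΘl0 hΘls hMl hZl hordl using hrest
  -- the re-centrings of all charts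
  let Θ : Fin 4 → (A 4 K ≃ₐ[K] A 4 K) := fun m =>
    if hmj : m = j then Θⱼ else if hm : m ∈ S ∧ m ∉ S'' then Θl m hm.1 hm.2 else AlgEquiv.refl
  have hΘj_eq : Θ j = Θⱼ := by simp only [Θ, dif_pos rfl]
  have hΘl_eq : ∀ m (hmS : m ∈ S) (hmS'' : m ∉ S''), Θ m = Θl m hmS hmS'' := fun m hmS hmS'' => by
    have hmj : m ≠ j := fun h => hmS'' (h ▸ hjS'')
    simp only [Θ, dif_neg hmj, dif_pos (show m ∈ S ∧ m ∉ S'' from ⟨hmS, hmS''⟩)]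
  have hcase : ∀ m, m ∈ S → (m = j ∨ m ∉ S'') → m ≠ j → m ∈ S ∧ m ∉ S'' := fun m hmS hmj hne => by
    rcases hmj with h | h
    · exact absurd h hne
    · exact ⟨hmS, h⟩
  refine ⟨Θ, fun m hmS hmj i => ?_, fun m hmS hmj => ?_, fun m hmS hmj => ⟨?_, ?_, ?_⟩, ?_⟩
  · by_cases hmj' : m = j
    · subst hmj'; rw [hΘj_eq]; exact hΘs i
    · obtain ⟨-, hmS''⟩ := hcase m hmS hmj hmj'
      rw [hΘl_eq m hmS hmS'']; exact hΘls m hmS hmS'' i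
  · by_cases hmj' : m = j
    · subst hmj'; exact ⟨hh, by rw [hΘj_eq]; exact hΘ0⟩
    · obtain ⟨-, hmS''⟩ := hcase m hmS hmj hmj'
      exact ⟨gl m hmS hmS'', by rw [hΘl_eq m hmS hmS'']; exact hΘl0 m hmS hmS''⟩
  · by_cases hmj' : m = j
    · subst hmj'
      rw [if_pos rfl, hΘj_eq]
      exact hZj
    · obtain ⟨-, hmS''⟩ := hcase m hmS hmj hmj'
      rw [if_neg hmj', hΘl_eq m hmS hmS'', hΘj_eq]
      exact hZl m hmS hmS''
  · by_cases hmj' : m = j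
    · subst hmj'
      rw [if_pos rfl, hΘj_eq, ← hMj, MarkedIdeal.transform_ideal]
    · obtain ⟨-, hmS''⟩ := hcase m hmS hmj hmj'
      rw [if_neg hmj', hΘl_eq m hmS hmS'', ← hMl m hmS hmS'', MarkedIdeal.transform_ideal]
  · by_cases hmj' : m = j
    · rw [if_pos hmj', if_pos hmj']; exact hperm'
    · obtain ⟨-, hmS''⟩ := hcase m hmS hmj hmj'
      rw [if_neg hmj', if_neg hmj']; exact hordl m hmS hmS''
  · intro z hz
    rw [hΘj_eq] at hz
    obtain ⟨m, hm, hzm⟩ := Set.mem_iUnion₂.mp (hcov hz)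
    obtain ⟨hmS, hmE⟩ := Finset.mem_sdiff.mp hm
    have hmj : m = j ∨ m ∉ S'' := by
      by_cases hmj : m = j
      · exact Or.inl hmj
      · exact Or.inr fun h => hmE (Finset.mem_erase.mpr ⟨hmj, h⟩)
    refine Set.mem_iUnion.mpr ⟨m, Set.mem_iUnion.mpr ⟨hmS, Set.mem_iUnion.mpr ⟨hmj, ?_⟩⟩⟩
    rw [ChartDictionary.range_specMap_comp_chartImm hB _ (Θ m)]
    exact hzm

end ChildModel

end Equimultiple

end Summit.ResolutionOfSingularities.ResolutionOfSingularities.Theorems.PIDim4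

end
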